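import Summits.CriticalPhenomena.SAWScalingLimit.Theorems.SAWLeftRightFKGFKGToTraversalBoundGermTightBdry
import HarnessLib

/-!
# Germ tightness is free at a SHALLOW marked point (stub `germTight_of_shallow`)

Crux `SAWLeftRightFKG.FKGToTraversalBound` (stmt-CriticalPhenomena-1878), line `slit-necklace`, registered stub
`germTight_of_shallow`.  `GermTight D a b e` (`Theorems/SAWLeftRightFKGFKGToTraversalBoundSlitNecklaceDefs.lean`)
asks, for every fixed outer radius `r > 0` and every `ε > 0`, for a threshold `n` such that eventually in `δ` the
critical chord makes `n` separate traversals of the endpoint-centred shell `D(δ·e_δ; ι(δ), r)`,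
`ι(δ) = 2·dist(δ·e_δ, ℂ ∖ D) + 4δ`, with probability `≤ ε`.

This file proves it on the SHALLOW class `dist(δ·e_δ, ℂ ∖ D) ≤ K δ` (eventually in `δ`), generalising the landed
lattice-boundary case `germTight_of_eventually_mem_meshBoundary` (depth `≤ δ`,
`Theorems/SAWLeftRightFKGFKGToTraversalBoundGermTightBdry.lean`) verbatim: with `L = 2 · max K 0 + 4` the inner
radius satisfies `0 < 4δ ≤ ι(δ) ≤ L δ < r` on the germ `0 < δ < r / L`, so the scale-free Aizenman–Burchard
short-distance cutoff `GatesByBubbleDoorsByFKG.not_hasTraversals_of_radius_le_mul_mesh` (no self-avoiding mesh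
polyline makes `N = 2((2n+1)²(2n+1)² + 1) + 1` separate traversals of a shell of inner radius `≤ L δ`,
`n = ⌈L⌉₊ + 2`) makes the traversal event EMPTY; the threshold `N` depends on `K` only (not on `r`, `ε`, `δ`).
A negative `K` is harmless (`max K 0`; the hypothesis then contradicts `infDist_nonneg` for `δ > 0`, but no case
analysis is needed).  Stated first for a general linear bound `ι(δ) ≤ L δ` (`germTight_of_inner_le_mul_mesh`),
then specialised (`germTight_of_shallow`, registered signature) and paired over both marked points
(`germTight_pair_of_shallow`).  Only theorems; no named fact; no new definition.
-/

noncomputable section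

open MeasureTheory Filter Topology Set Metric
open scoped NNReal ENNReal
open Literature.Probability.LatticeModels
open Literature.Probability.RandomPlanarGeometry
open Literature.Probability.RandomPlanarGeometry.SAW
open Summit.CriticalPhenomena.SAWScalingLimit.Theorems.FKGToTraversalBound.GatesByBubbleDoorsByFKG
  (not_hasTraversals_of_radius_le_mul_mesh)

namespace Summit.CriticalPhenomena.SAWScalingLimit.Theorems.FKGToTraversalBound.SlitNecklace

/-! ### Germ tightness below a linear inner radius is deterministic -/

/-- **Germ tightness when the germ shell has inner radius `O(δ)`.** If eventually in `δ` the inner radius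
`ι(δ) = 2·dist(δ·e_δ, ℂ ∖ D) + 4δ` of the endpoint-centred germ shell is at most `L δ` (`L > 0`), then
`GermTight D a b e` holds with the scale-free cutoff count `N = 2((2n+1)²(2n+1)² + 1) + 1`, `n = ⌈L⌉₊ + 2`, for
every `r` and `ε`: on the germ `0 < δ < r / L` one has `0 < ι(δ) ≤ L δ < r` (`infDist_nonneg`), so by
`not_hasTraversals_of_radius_le_mul_mesh` no chord makes `N` separate traversals and the event is empty.
[folklore] -/
theorem germTight_of_inner_le_mul_mesh {D : DobrushinDomain} {a b e : ℝ → Site 2} {L : ℝ} (hL : 0 < L)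
    (h : ∀ᶠ δ in 𝓝[>] (0 : ℝ), 2 * infDist (meshPoint δ (e δ)) D.carrierᶜ + 4 * δ ≤ L * δ) :
    GermTight D a b e := by
  intro r hr ε _
  refine ⟨2 * ((2 * (⌈L⌉₊ + 2) + 1) ^ 2 * (2 * (⌈L⌉₊ + 2) + 1) ^ 2 + 1) + 1, ?_⟩
  have hsmall : Set.Ioo (0 : ℝ) (r / L) ∈ 𝓝[>] (0 : ℝ) := Ioo_mem_nhdsGT (by positivity)
  filter_upwards [hsmall, h] with δ hδ hρL
  have hδpos : 0 < δ := hδ.1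
  have hLr : δ * L < r := (lt_div_iff₀ hL).1 hδ.2
  have hd0 : 0 ≤ infDist (meshPoint δ (e δ)) D.carrierᶜ := infDist_nonneg
  have hρ : 0 < 2 * infDist (meshPoint δ (e δ)) D.carrierᶜ + 4 * δ := by linarith
  have hρr : 2 * infDist (meshPoint δ (e δ)) D.carrierᶜ + 4 * δ < r := by linarith
  have hempty : {γ : DomainSAW D.carrier δ (a δ) (b δ) |
      (polyline γ).HasTraversals
        (2 * ((2 * (⌈L⌉₊ + 2) + 1) ^ 2 * (2 * (⌈L⌉₊ + 2) + 1) ^ 2 + 1) + 1)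
        (meshPoint δ (e δ)) (2 * infDist (meshPoint δ (e δ)) D.carrierᶜ + 4 * δ) r} = ∅ :=
    Set.eq_empty_of_forall_notMem fun γ hγ =>
      not_hasTraversals_of_radius_le_mul_mesh hδpos hρ hρL hρr γ (meshPoint δ (e δ)) hγ
  rw [hempty, measure_empty]
  exact bot_le

/-! ### The registered stub -/

/-- **`GermTight` at a shallow marked point** (registered stub `germTight_of_shallow` of
stmt-CriticalPhenomena-1878, line `slit-necklace`).  If the depth of the lattice endpoint is eventually `O(δ)`,
`dist(δ·e_δ, ℂ ∖ D) ≤ K δ`, then germ tightness holds at `e`, deterministically: with `L = 2 · max K 0 + 4` the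
inner radius of the germ shell is between `4δ` and `L δ`, below which the scale-free short-distance cutoff empties
the traversal event (`germTight_of_inner_le_mul_mesh`).  Hence the germ input `stub_germTight` has content only
on the deep fragment `depth(δ)/δ → ∞`. [folklore] -/
theorem germTight_of_shallow : ∀ (D : DobrushinDomain) (a b e : ℝ → Site 2) (K : ℝ),
    (∀ᶠ δ in 𝓝[>] (0 : ℝ), infDist (meshPoint δ (e δ)) D.carrierᶜ ≤ K * δ) → GermTight D a b e := by
  intro D a b e K hK
  refine germTight_of_inner_le_mul_mesh (L := 2 * max K 0 + 4) (by positivity) ?_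
  filter_upwards [self_mem_nhdsWithin, hK] with δ hδ hKδ
  have hδpos : 0 < δ := hδ
  have hmax : K * δ ≤ max K 0 * δ := mul_le_mul_of_nonneg_right (le_max_left K 0) hδpos.le
  linarith

/-- **`GermTight` at both marked points of a shallow approximation.**  If along the approximation both depths are
eventually `O(δ)`, germ tightness holds at both marked points (`germTight_of_shallow` twice). [folklore] -/
theorem germTight_pair_of_shallow : ∀ (D : DobrushinDomain) (a b : ℝ → Site 2) (K : ℝ),
    (∀ᶠ δ in 𝓝[>] (0 : ℝ), infDist (meshPoint δ (a δ)) D.carrierᶜ ≤ K * δ ∧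
      infDist (meshPoint δ (b δ)) D.carrierᶜ ≤ K * δ) → GermTight D a b a ∧ GermTight D a b b := by
  intro D a b K h
  exact ⟨germTight_of_shallow D a b a K (h.mono fun δ hδ => hδ.1),
    germTight_of_shallow D a b b K (h.mono fun δ hδ => hδ.2)⟩

end Summit.CriticalPhenomena.SAWScalingLimit.Theorems.FKGToTraversalBound.SlitNecklace

end
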